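import Summits.KontsevichZagierPeriods.Zeta5Search.WedgeDictionaryOmegaRecGeneric


/-!
# Wedge dictionary — the four-term recurrence REC3′ of the terminating very-well-poised sum in one slot (L8)

HONEST FRAMING: systematic search; no irrationality claim unless certified.

Generic-parameter version (the running parameter `x` is an element of a field `K` of characteristic
zero — instantiate `K = RatFunc ℚ`, `x = X` and specialise, exactly as `B` must be generic in
PROOF-NOTES-g5 §4.6; or `K = ℚ` when no pivot vanishes).  For `n : K`, six side parameters
`c : Fin 6 → K` and `μ : ℕ` put (`ph` = rising factorial of `HypergeometricSaalschutz`)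

* `om n c μ  = (1 − 2μ/(n+1))·(−n−1)_μ/μ! · ∏ᵢ (−cᵢ)_μ/(cᵢ−n)_μ`       (the slot-independent core),
* `tT n c x μ = om n c μ · (−x)_μ/(x−n)_μ`                              (the `omegaVWP` summand, slot 7 = x),
* `gG n c x μ` = the POLE-FREE certificate value `G(x,μ)` (`gG … 0 = 0`),
* `EK c t = ∏ᵢ (t − cᵢ)`.

This file proves the five PIVOT CROSS RELATIONS tying `tT (x+1)`, `tT (x−1)`, `tT (x−2)`, `gG x μ`,
`gG x (μ+1)` to the pivot `tT x μ` (one-factor peels, `ph_shift`/`ph_succ`), under the natural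
non-vanishing hypotheses.  Together with `Telescope.termwise_of_pivot` (staged v2 of
`WedgeDictionaryTelescope.lean`) they give the termwise certificate identity and, summed over `μ ≤ M`,
REC3′ (PROOF-NOTES-g5 §10.2).  Written by planner gen-1 g5.

Filed by typer g6 for gen-1 g5 (parts 1–2: `WedgeDictionaryOmegaRecCore`, `WedgeDictionaryOmegaRecGeneric`; this is part 3/3:
the specialisation to an integer running parameter and the bridge `omegaVWP_rec3`).
-/


noncomputable section

open Finset Polynomial

namespace Summit.KontsevichZagierPeriods.Zeta5Search.WedgeDictionary.OmegaRec

open Summit.KontsevichZagierPeriods.Zeta5Search.Hypergeometric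

/-! ## Specialisation: clearing the window denominator, the `RatFunc ℚ` instance, the integer instance -/
section Specialise

/-- the window polynomial `W = ∏_{j<M+3} (X + (j − n − 2))`. -/
def Wp (n : ℚ) (M : ℕ) : ℚ[X] := ∏ j ∈ range (M + 3), (X + C ((j : ℚ) - n - 2))

/-- cofactor of the slot denominator window inside `W`; the slot is `x + (k − 2)`, `k ∈ {0,1,2,3}`. -/
def cofp (n : ℚ) (M k μ : ℕ) : ℚ[X] :=
  (∏ j ∈ range k, (X + C ((j : ℚ) - n - 2))) * ∏ j ∈ Ico (k + μ) (M + 3), (X + C ((j : ℚ) - n - 2))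

/-- `(ascPochhammer ℚ[X] μ).eval y = ∏_{j<μ} (y + j)`. -/
theorem asc_eval_eq_prod (y : ℚ[X]) (μ : ℕ) :
    (ascPochhammer ℚ[X] μ).eval y = ∏ j ∈ range μ, (y + (j : ℚ[X])) := by
  induction μ with
  | zero => simp
  | succ k ih => rw [ascPochhammer_succ_eval, ih, Finset.prod_range_succ]

/-- WINDOW SPLITTING: `(x_k − n)_μ · cof = W` in `ℚ[X]` (`x_k = X + (k − 2)`). -/
theorem window (n : ℚ) (M k μ : ℕ) (h : k + μ ≤ M + 3) :
    (ascPochhammer ℚ[X] μ).eval (X + C ((k : ℚ) - n - 2)) * cofp n M k μ = Wp n M := by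
  rw [asc_eval_eq_prod, cofp, Wp]
  have h1 : ∏ j ∈ range μ, (X + C ((k : ℚ) - n - 2) + (j : ℚ[X])) =
      ∏ j ∈ Ico k (k + μ), (X + C ((j : ℚ) - n - 2)) := by
    rw [Finset.prod_Ico_eq_prod_range, add_tsub_cancel_left]
    refine Finset.prod_congr rfl (fun j _ => ?_)
    simp only [Nat.cast_add, map_sub, map_add, map_natCast, map_ofNat]
    ring
  rw [h1, ← Finset.prod_range_mul_prod_Ico _ h, ← Finset.prod_range_mul_prod_Ico _ (Nat.le_add_right k μ)]
  ring

/-- the cleared polynomial summand of slot `x + (k − 2)`: `om(μ)·(−x_k)_μ·cof`. -/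
def Tpoly (n : ℚ) (c : Fin 6 → ℚ) (M k μ : ℕ) : ℚ[X] :=
  C (om n c μ) * (ascPochhammer ℚ[X] μ).eval (-(X + C ((k : ℚ) - 2))) * cofp n M k μ

variable {K : Type*} [Field K] [CharZero K]

omit [CharZero K] in
/-- A ring hom out of `ℚ[X]` sends `C q` to the cast of `q`. -/
theorem hom_C (g : ℚ[X] →+* K) (q : ℚ) : g (C q) = (q : K) :=
  eq_ratCast (g.comp (Polynomial.C : ℚ →+* ℚ[X])) q

omit [CharZero K] in
/-- A ring hom out of `ℚ[X]` maps rising factorials to rising factorials. -/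
theorem hom_asc (g : ℚ[X] →+* K) (μ : ℕ) (y : ℚ[X]) :
    g ((ascPochhammer ℚ[X] μ).eval y) = ph (g y) μ := by
  unfold ph; rw [← Polynomial.eval₂_hom, ← Polynomial.eval_map, ascPochhammer_map]

/-- pushing a ring hom `g : ℚ[X] → K` through the cleared summand. -/
theorem map_Tpoly (g : ℚ[X] →+* K) (n : ℚ) (c : Fin 6 → ℚ) (M k μ : ℕ) (h : k + μ ≤ M + 3)
    (hden : ph (g X + ((k : K) - 2) - n) μ ≠ 0) :
    g (Tpoly n c M k μ) = g (Wp n M) * tT (n : K) (fun i => (c i : K)) (g X + ((k : K) - 2)) μ := by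
  have hw := congrArg g (window n M k μ h)
  rw [map_mul, hom_asc] at hw
  have hy2 : g (X + C ((k : ℚ) - n - 2)) = g X + ((k : K) - 2) - n := by
    rw [map_add, hom_C]; push_cast; ring
  rw [hy2] at hw
  have hom : g (C (om n c μ)) = om (n : K) (fun i => (c i : K)) μ := by
    have := om_map (g.comp (Polynomial.C : ℚ →+* ℚ[X])) n c μ
    simpa [hom_C] using this
  have hy : g (-(X + C ((k : ℚ) - 2))) = -(g X + ((k : K) - 2)) := by
    rw [map_neg, map_add, hom_C]; push_cast; ring
  unfold Tpoly tT
  rw [map_mul, map_mul, hom_asc, hom, hy, ← hw]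
  field_simp

/-- the cleared form of REC3′ as ONE polynomial in `ℚ[X]`. -/
def Big (n : ℚ) (c : Fin 6 → ℚ) (M : ℕ) : ℚ[X] :=
  Pup (C n) (fun i => C (c i)) X * ∑ μ ∈ range (M + 1), Tpoly n c M 3 μ +
    Pz (C n) (fun i => C (c i)) X * ∑ μ ∈ range (M + 1), Tpoly n c M 2 μ +
    Pm1 (C n) (fun i => C (c i)) X * ∑ μ ∈ range (M + 1), Tpoly n c M 1 μ +
    Pm2 (C n) (fun i => C (c i)) X * ∑ μ ∈ range (M + 1), Tpoly n c M 0 μ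

/-- pushing a ring hom through `Big`: `g(Big) = g(W) · (REC3′ expression at x = g X)`. -/
theorem map_Big (g : ℚ[X] →+* K) (n : ℚ) (c : Fin 6 → ℚ) (M : ℕ)
    (hden : ∀ k : ℕ, k ≤ 3 → ∀ μ : ℕ, μ ≤ M → ph (g X + ((k : K) - 2) - n) μ ≠ 0) :
    g (Big n c M) = g (Wp n M) *
      (Pup (n : K) (fun i => (c i : K)) (g X) * OmS (n : K) (fun i => (c i : K)) (g X + 1) M +
        Pz (n : K) (fun i => (c i : K)) (g X) * OmS (n : K) (fun i => (c i : K)) (g X) M +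
        Pm1 (n : K) (fun i => (c i : K)) (g X) * OmS (n : K) (fun i => (c i : K)) (g X - 1) M +
        Pm2 (n : K) (fun i => (c i : K)) (g X) * OmS (n : K) (fun i => (c i : K)) (g X - 2) M) := by
  have hsum : ∀ k : ℕ, k ≤ 3 → g (∑ μ ∈ range (M + 1), Tpoly n c M k μ) =
      g (Wp n M) * ∑ μ ∈ range (M + 1), tT (n : K) (fun i => (c i : K)) (g X + ((k : K) - 2)) μ := by
    intro k hk
    rw [map_sum, Finset.mul_sum]
    refine Finset.sum_congr rfl (fun μ hμ => ?_)
    have hμ' : μ ≤ M := Nat.lt_succ_iff.mp (Finset.mem_range.mp hμ)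
    exact map_Tpoly g n c M k μ (by omega) (hden k hk μ hμ')
  have e3 : g X + ((((3 : ℕ) : K)) - 2) = g X + 1 := by push_cast; ring
  have e2 : g X + ((((2 : ℕ) : K)) - 2) = g X := by push_cast; ring
  have e1 : g X + ((((1 : ℕ) : K)) - 2) = g X - 1 := by push_cast; ring
  have e0 : g X + ((((0 : ℕ) : K)) - 2) = g X - 2 := by push_cast; ring
  simp only [Big, map_add, map_mul, Pup_map, Pz_map, Pm1_map, Pm2_map, hom_C]
  rw [hsum 3 (by norm_num), hsum 2 (by norm_num), hsum 1 (by norm_num), hsum 0 (by norm_num), e3, e2, e1, e0]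
  simp only [OmS]
  ring

/-- `Big = 0`: the `RatFunc ℚ` instance of `rec3'` (every pivot/denominator is a product of `X − const`). -/
theorem Big_eq_zero (n : ℕ) (c : Fin 6 → ℕ) (M : ℕ) (i₀ : Fin 6) (hM : c i₀ = M)
    (hcn : ∀ i, c i + M ≤ n) : Big (n : ℚ) (fun i => (c i : ℚ)) M = 0 := by
  let g : ℚ[X] →+* RatFunc ℚ := algebraMap ℚ[X] (RatFunc ℚ)
  have ginj : Function.Injective g := RatFunc.algebraMap_injective ℚ
  set nF : RatFunc ℚ := ((n : ℚ) : RatFunc ℚ) with hnF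
  set cF : Fin 6 → RatFunc ℚ := fun i => ((c i : ℚ) : RatFunc ℚ) with hcF
  -- linear forms in X do not vanish
  have hlin : ∀ a : ℚ, g X + (a : RatFunc ℚ) ≠ 0 := by
    intro a h
    have h' : g (X + C a) = g 0 := by rw [map_add, hom_C, map_zero]; exact h
    exact X_add_C_ne_zero a (ginj h')
  have hph : ∀ (a : ℚ) (k : ℕ), ph (g X + (a : RatFunc ℚ)) k ≠ 0 := fun a k =>
    ph_ne_zero_of _ _ (fun j _ => by
      have := hlin (a + j)
      push_cast at this
      rwa [← add_assoc] at this)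
  have h2M : 2 * M ≤ n := by have := hcn i₀; omega
  -- the side denominators `(cᵢ − n)_μ`, μ ≤ M, are products of negative rationals
  have hc : ∀ μ ≤ M, ∀ i, ph (cF i - nF) μ ≠ 0 := by
    intro μ hμ i
    refine ph_ne_zero_of _ _ (fun j hj => ?_)
    have hci := hcn i
    have hq : ((c i : ℚ) - n + j : ℚ) ≠ 0 := by
      have : ((c i : ℚ) - n + j : ℚ) < 0 := by
        have h' : (c i + j : ℚ) < n := by exact_mod_cast (by omega : c i + j < n)
        linarith
      exact ne_of_lt this
    have : (((c i : ℚ) - n + j : ℚ) : RatFunc ℚ) ≠ 0 := by exact_mod_cast hq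
    simpa [hcF, hnF] using this
  have hgood : ∀ μ ≤ M, Good nF cF (g X) μ := by
    intro μ hμ
    refine ⟨?_, hc μ hμ, ?_, ?_, ?_, ?_, ?_⟩
    · have : ((n : ℚ) + 1 : ℚ) ≠ 0 := by positivity
      have : (((n : ℚ) + 1 : ℚ) : RatFunc ℚ) ≠ 0 := by exact_mod_cast this
      simpa [hnF] using this
    · convert hph (-(n : ℚ)) (μ + 1) using 2; simp [hnF]; ring
    · convert hph (1 - (n : ℚ)) μ using 2; simp [hnF]; ring
    · convert hph (-1 - (n : ℚ)) μ using 2; simp [hnF]; ring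
    · convert hph (-2 - (n : ℚ)) μ using 2; simp [hnF]; ring
    · simp only [Zpiv]
      have hsc : (nF + 1 - 2 * (μ : RatFunc ℚ)) ≠ 0 := by
        have : ((n : ℚ) + 1 - 2 * μ : ℚ) ≠ 0 := by
          have : (2 * μ : ℚ) ≤ n := by exact_mod_cast (by omega : 2 * μ ≤ n)
          linarith
        have : (((n : ℚ) + 1 - 2 * μ : ℚ) : RatFunc ℚ) ≠ 0 := by exact_mod_cast this
        simpa [hnF] using this
      refine mul_ne_zero (mul_ne_zero (mul_ne_zero (mul_ne_zero (mul_ne_zero (mul_ne_zero ?_ ?_) ?_) ?_) ?_) ?_) hsc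
      · convert hlin (1 - (μ : ℚ)) using 1; push_cast; ring
      · convert hlin ((μ : ℚ) - n) using 1; simp [hnF]; ring
      · convert hlin 0 using 1; simp
      · convert hlin (-1) using 1; push_cast; ring
      · convert hlin (-(n : ℚ) - 1) using 1; simp [hnF]; ring
      · convert hlin (-(n : ℚ) - 2) using 1; simp [hnF]; ring
  have hi : ph (-cF i₀) (M + 1) = 0 := by
    have : cF i₀ = (M : RatFunc ℚ) := by simp [hcF, hM]
    rw [this]; exact ph_neg_nat_succ M
  have R := rec3' nF cF (g X) M hgood i₀ hi
  have hden : ∀ k : ℕ, k ≤ 3 → ∀ μ : ℕ, μ ≤ M → ph (g X + ((k : RatFunc ℚ) - 2) - (n : ℚ)) μ ≠ 0 := by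
    intro k _ μ _
    convert hph ((k : ℚ) - 2 - n) μ using 2; push_cast; ring
  have HB := map_Big g (n : ℚ) (fun i => (c i : ℚ)) M hden
  rw [R, mul_zero] at HB
  exact ginj (by rw [HB, map_zero])

/-- **REC3′ at an integer running parameter `B`** (the instance used in the induction along slot 7):
for natural `n, c` with termination index `M = c i₀`, `cᵢ + M ≤ n`, and an integer `B` with `B + M + 1 ≤ n`. -/
theorem rec3'_int (n : ℕ) (c : Fin 6 → ℕ) (M : ℕ) (i₀ : Fin 6) (hM : c i₀ = M)
    (hcn : ∀ i, c i + M ≤ n) (B : ℤ) (hB : B + M + 1 ≤ n) :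
    Pup (n : ℚ) (fun i => (c i : ℚ)) (B : ℚ) * OmS (n : ℚ) (fun i => (c i : ℚ)) ((B : ℚ) + 1) M +
        Pz (n : ℚ) (fun i => (c i : ℚ)) (B : ℚ) * OmS (n : ℚ) (fun i => (c i : ℚ)) (B : ℚ) M +
        Pm1 (n : ℚ) (fun i => (c i : ℚ)) (B : ℚ) * OmS (n : ℚ) (fun i => (c i : ℚ)) ((B : ℚ) - 1) M +
        Pm2 (n : ℚ) (fun i => (c i : ℚ)) (B : ℚ) * OmS (n : ℚ) (fun i => (c i : ℚ)) ((B : ℚ) - 2) M = 0 := by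
  let g : ℚ[X] →+* ℚ := Polynomial.evalRingHom (B : ℚ)
  have hgX : g X = (B : ℚ) := Polynomial.eval_X
  have hfac : ∀ (a : ℤ) (j : ℕ), a + j < 0 → ((a : ℚ) + j : ℚ) ≠ 0 := by
    intro a j h
    have h' : ((a + j : ℤ) : ℚ) < 0 := by exact_mod_cast h
    push_cast at h'
    exact ne_of_lt h'
  have hden : ∀ k : ℕ, k ≤ 3 → ∀ μ : ℕ, μ ≤ M → ph (g X + ((k : ℚ) - 2) - (n : ℚ)) μ ≠ 0 := by
    intro k hk μ hμ
    rw [hgX]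
    refine ph_ne_zero_of _ _ (fun j hj => ?_)
    have := hfac (B + k - 2 - n) j (by omega)
    push_cast at this
    convert this using 1; ring
  have HB := map_Big g (n : ℚ) (fun i => (c i : ℚ)) M hden
  rw [Big_eq_zero n c M i₀ hM hcn, map_zero] at HB
  have hW : g (Wp n M) ≠ 0 := by
    simp only [Wp, map_prod, map_add, hom_C, hgX]
    refine Finset.prod_ne_zero_iff.mpr (fun j hj => ?_)
    have hj' := Finset.mem_range.mp hj
    have := hfac (B - n - 2) j (by omega)
    push_cast at this
    convert this using 1; push_cast; ring
  have key := (mul_eq_zero.mp HB.symm).resolve_left hW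
  simpa [hgX] using key

end Specialise


/-! ## Bridge to the tree's language: `omegaVWP`, `bump · 6` and the `topGamma` coefficients -/
section Bridge

/-- `Ω(b)` (`omegaVWP`, summed to `b₀`) is the terminating sum `OmS` with slot 7 as the running slot and
termination index `M = c i₀` any row value among `b₁..b₆` with `M ≤ b₀` (in practice the minimum). -/
theorem omegaVWP_eq_OmS (b : ℕ → ℤ) (n : ℕ) (c : Fin 6 → ℕ) (M : ℕ) (i₀ : Fin 6)
    (hb0 : b 0 = n) (hbc : ∀ i : Fin 6, b ((i : ℕ) + 1) = c i) (hM : c i₀ = M) (hMn : M ≤ n) :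
    omegaVWP b = OmS (n : ℚ) (fun i => (c i : ℚ)) (b 7 : ℚ) M := by
  have hN : (b 0).toNat = n := by rw [hb0]; exact Int.toNat_natCast n
  have hb0q : (b 0 : ℚ) = (n : ℚ) := by rw [hb0]; push_cast; ring
  have hbcq : ∀ i : Fin 6, (b ((i : ℕ) + 1) : ℚ) = (c i : ℚ) := fun i => by rw [hbc i]; push_cast; ring
  unfold omegaVWP
  set F : ℕ → ℚ := fun m => (1 - 2 * (m : ℚ) / ((b 0 : ℚ) + 1)) *
      ((ascPochhammer ℚ m).eval (-(b 0 : ℚ) - 1) / (m.factorial : ℚ)) *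
      ∏ j ∈ range 7, (ascPochhammer ℚ m).eval (-(b (j + 1) : ℚ)) / (ascPochhammer ℚ m).eval ((b (j + 1) : ℚ) - b 0)
    with hF
  have hvan : ∀ m ∈ range (n + 1), m ∉ range (M + 1) → F m = 0 := by
    intro m _ hm
    have hm' : M < m := by rw [Finset.mem_range] at hm; omega
    have hz : (ascPochhammer ℚ m).eval (-(b ((i₀ : ℕ) + 1) : ℚ)) = 0 := by
      rw [hbcq i₀, hM]; exact ascPochhammer_eval_neg_coe_nat_of_lt hm'
    simp only [hF]
    rw [Finset.prod_eq_zero (Finset.mem_range.2 (by omega : (i₀ : ℕ) < 7)) (by rw [hz, zero_div]), mul_zero]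
  rw [hN, ← Finset.sum_subset (Finset.range_subset_range.2 (by omega : M + 1 ≤ n + 1)) hvan]
  unfold OmS
  refine Finset.sum_congr rfl (fun m _ => ?_)
  simp only [hF, tT, om, ph]
  rw [Finset.prod_range_succ, ← Fin.prod_univ_eq_prod_range
    (fun j => (ascPochhammer ℚ m).eval (-(b (j + 1) : ℚ)) / (ascPochhammer ℚ m).eval ((b (j + 1) : ℚ) - b 0)) 6]
  simp only [hb0q, hbcq, show (6 : ℕ) + 1 = 7 from rfl]
  ring

/-- dictionary: the tree's `topGamma1` is the generic `gammaOne` at `β = b₇`. -/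
theorem topGamma1_eq_gammaOne (b : ℕ → ℤ) :
    topGamma1 b = gammaOne (b 0 : ℚ) (b 7 : ℚ) (fe1 b) (fe2 b) (fe3 b) (fe4 b) (fe5 b) := by
  unfold topGamma1 topA1 topA2 topA3 yNode gammaOne qA1 qA2 qA3 yN
  ring

/-- dictionary: the tree's `topGamma2` is the generic `gammaTwo` at `β = b₇`. -/
theorem topGamma2_eq_gammaTwo (b : ℕ → ℤ) :
    topGamma2 b = gammaTwo (b 0 : ℚ) (b 7 : ℚ) (fe1 b) (fe2 b) (fe3 b) := by
  unfold topGamma2 topA2 topA3 yNode gammaTwo qA2 qA3 yN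
  ring

set_option maxRecDepth 4000 in
/-- **REC3′ in the tree's language.** For a shape `a` (rows `a₁..a₆ ≥ 0`, `a₀ ≥ 0`) put `B = a₇ + 2`,
`n = a₀`; if `aᵢ + a₇ + 3 ≤ n` (`i ≤ 6`) and `aᵢ + aⱼ ≤ n` (`i ≠ j ≤ 6`), then
`−∏ᵢ(n−B−aᵢ)·Ω(a+3e₇) − (n−B)·γ₁(a+e₇)·Ω(a+2e₇) − (n−B)·B·(n+1−B)·γ₂(a)·Ω(a+e₇)
   + (n−B)·B·(B−1)·(n+1−B)·(n+2−B)·(3n+2−B−e₁)·Ω(a) = 0`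
(`γ_k = topGamma_k`, `e₁ = fe1 a`, `a + e₇ = bump a 6`; no hypothesis on `a₇` beyond the first one). -/
theorem omegaVWP_rec3 (a : ℕ → ℤ) (h0 : 0 ≤ a 0) (hrow : ∀ i ∈ range 6, 0 ≤ a (i + 1))
    (hp7 : ∀ i ∈ range 6, a (i + 1) + a 7 + 3 ≤ a 0)
    (hpr : ∀ i ∈ range 6, ∀ j ∈ range 6, i ≠ j → a (i + 1) + a (j + 1) ≤ a 0) :
    -(∏ i ∈ range 6, ((a 0 : ℚ) - ((a 7 : ℚ) + 2) - a (i + 1))) * omegaVWP (bump (bump (bump a 6) 6) 6) -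
        ((a 0 : ℚ) - ((a 7 : ℚ) + 2)) * topGamma1 (bump a 6) * omegaVWP (bump (bump a 6) 6) -
        ((a 0 : ℚ) - ((a 7 : ℚ) + 2)) * ((a 7 : ℚ) + 2) * ((a 0 : ℚ) + 1 - ((a 7 : ℚ) + 2)) * topGamma2 a *
          omegaVWP (bump a 6) +
        ((a 0 : ℚ) - ((a 7 : ℚ) + 2)) * ((a 7 : ℚ) + 2) * ((a 7 : ℚ) + 1) * ((a 0 : ℚ) + 1 - ((a 7 : ℚ) + 2)) *
          ((a 0 : ℚ) + 2 - ((a 7 : ℚ) + 2)) * (3 * (a 0 : ℚ) + 2 - ((a 7 : ℚ) + 2) - fe1 a) * omegaVWP a = 0 := by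
  -- natural-number parameters
  set n : ℕ := (a 0).toNat with hndef
  set c : Fin 6 → ℕ := fun i => (a ((i : ℕ) + 1)).toNat with hcdef
  obtain ⟨i₀, -, hi₀⟩ := Finset.exists_min_image Finset.univ c Finset.univ_nonempty
  have hnz : a 0 = (n : ℤ) := (Int.toNat_of_nonneg h0).symm
  have hcz : ∀ i : Fin 6, a ((i : ℕ) + 1) = (c i : ℤ) := fun i =>
    (Int.toNat_of_nonneg (hrow i (Finset.mem_range.2 i.isLt))).symm
  have hMle : ∀ i, c i₀ ≤ c i := fun i => hi₀ i (Finset.mem_univ i)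
  obtain ⟨j₀, hj₀⟩ := exists_ne i₀
  have hcn : ∀ i, c i + c i₀ ≤ n := by
    intro i
    by_cases hi : i = i₀
    · have hne : (j₀ : ℕ) ≠ (i₀ : ℕ) := fun h => hj₀ (Fin.ext h)
      have := hpr j₀ (Finset.mem_range.2 j₀.isLt) i₀ (Finset.mem_range.2 i₀.isLt) hne
      rw [hcz j₀, hcz i₀, hnz] at this
      have := hMle j₀
      subst hi; omega
    · have hne : (i : ℕ) ≠ (i₀ : ℕ) := fun h => hi (Fin.ext h)
      have := hpr i (Finset.mem_range.2 i.isLt) i₀ (Finset.mem_range.2 i₀.isLt) hne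
      rw [hcz i, hcz i₀, hnz] at this
      omega
  have hB : (a 7 + 2) + (c i₀ : ℤ) + 1 ≤ n := by
    have := hp7 i₀ (Finset.mem_range.2 i₀.isLt)
    rw [hcz i₀, hnz] at this
    omega
  have hMn : c i₀ ≤ n := by have := hcn i₀; omega
  -- the generic recurrence at the integer point `B = a₇ + 2`
  have R := rec3'_int n c (c i₀) i₀ rfl hcn (a 7 + 2) hB
  -- the four shapes along slot 7
  have hb1_0 : bump a 6 0 = a 0 := bump_zero a 6
  have hb1_7 : bump a 6 7 = a 7 + 1 := bump_self a 6
  have hb1_r : ∀ i : Fin 6, bump a 6 ((i : ℕ) + 1) = a ((i : ℕ) + 1) := fun i =>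
    bump_of_ne a (by have := i.isLt; omega)
  have hb2_0 : bump (bump a 6) 6 0 = a 0 := by rw [bump_zero, hb1_0]
  have hb2_7 : bump (bump a 6) 6 7 = a 7 + 2 := by
    rw [show (7 : ℕ) = 6 + 1 from rfl, bump_self, hb1_7]; ring
  have hb2_r : ∀ i : Fin 6, bump (bump a 6) 6 ((i : ℕ) + 1) = a ((i : ℕ) + 1) := fun i => by
    rw [bump_of_ne _ (by have := i.isLt; omega), hb1_r i]
  have hb3_0 : bump (bump (bump a 6) 6) 6 0 = a 0 := by rw [bump_zero, hb2_0]
  have hb3_7 : bump (bump (bump a 6) 6) 6 7 = a 7 + 3 := by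
    rw [show (7 : ℕ) = 6 + 1 from rfl, bump_self, hb2_7]; ring
  have hb3_r : ∀ i : Fin 6, bump (bump (bump a 6) 6) 6 ((i : ℕ) + 1) = a ((i : ℕ) + 1) := fun i => by
    rw [bump_of_ne _ (by have := i.isLt; omega), hb2_r i]
  rw [omegaVWP_eq_OmS (bump (bump (bump a 6) 6) 6) n c (c i₀) i₀ (by rw [hb3_0, hnz])
      (fun i => by rw [hb3_r i, hcz i]) rfl hMn,
    omegaVWP_eq_OmS (bump (bump a 6) 6) n c (c i₀) i₀ (by rw [hb2_0, hnz])
      (fun i => by rw [hb2_r i, hcz i]) rfl hMn,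
    omegaVWP_eq_OmS (bump a 6) n c (c i₀) i₀ (by rw [hb1_0, hnz]) (fun i => by rw [hb1_r i, hcz i]) rfl hMn,
    omegaVWP_eq_OmS a n c (c i₀) i₀ hnz hcz rfl hMn,
    hb3_7, hb2_7, hb1_7, topGamma1_eq_gammaOne, topGamma2_eq_gammaTwo]
  -- normalise the slot arguments and the casts on both sides
  have eB1 : ((a 7 + 2 : ℤ) : ℚ) + 1 = (a 7 : ℚ) + 3 := by push_cast; ring
  have eBm1 : ((a 7 + 2 : ℤ) : ℚ) - 1 = (a 7 : ℚ) + 1 := by push_cast; ring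
  have eBm2 : ((a 7 + 2 : ℤ) : ℚ) - 2 = (a 7 : ℚ) := by push_cast; ring
  have eB0 : ((a 7 + 2 : ℤ) : ℚ) = (a 7 : ℚ) + 2 := by push_cast; ring
  have e3 : ((a 7 + 3 : ℤ) : ℚ) = (a 7 : ℚ) + 3 := by push_cast; ring
  have e1 : ((a 7 + 1 : ℤ) : ℚ) = (a 7 : ℚ) + 1 := by push_cast; ring
  rw [eB1, eBm1, eBm2, eB0] at R
  rw [e3, eB0, e1]
  have hnq : ((n : ℕ) : ℚ) = (a 0 : ℚ) := by exact_mod_cast hnz.symm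
  have hc0 : ((c 0 : ℕ) : ℚ) = (a 1 : ℚ) := by exact_mod_cast (hcz 0).symm
  have hc1 : ((c 1 : ℕ) : ℚ) = (a 2 : ℚ) := by exact_mod_cast (hcz 1).symm
  have hc2 : ((c 2 : ℕ) : ℚ) = (a 3 : ℚ) := by exact_mod_cast (hcz 2).symm
  have hc3 : ((c 3 : ℕ) : ℚ) = (a 4 : ℚ) := by exact_mod_cast (hcz 3).symm
  have hc4 : ((c 4 : ℕ) : ℚ) = (a 5 : ℚ) := by exact_mod_cast (hcz 4).symm
  have hc5 : ((c 5 : ℕ) : ℚ) = (a 6 : ℚ) := by exact_mod_cast (hcz 5).symm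
  have hfe : ∀ k, k ≠ 7 → ((bump a 6 k : ℤ) : ℚ) = (a k : ℚ) := fun k hk => by rw [bump_of_ne a (by omega)]
  have hfe1 : fe1 (bump a 6) = fe1 a := by
    unfold fe1
    rw [hfe 1 (by norm_num), hfe 2 (by norm_num), hfe 3 (by norm_num), hfe 4 (by norm_num), hfe 5 (by norm_num),
      hfe 6 (by norm_num)]
  have hfe2 : fe2 (bump a 6) = fe2 a := by
    unfold fe2
    rw [hfe 1 (by norm_num), hfe 2 (by norm_num), hfe 3 (by norm_num), hfe 4 (by norm_num), hfe 5 (by norm_num),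
      hfe 6 (by norm_num)]
  have hfe3 : fe3 (bump a 6) = fe3 a := by
    unfold fe3
    rw [hfe 1 (by norm_num), hfe 2 (by norm_num), hfe 3 (by norm_num), hfe 4 (by norm_num), hfe 5 (by norm_num),
      hfe 6 (by norm_num)]
  have hfe4 : fe4 (bump a 6) = fe4 a := by
    unfold fe4
    rw [hfe 1 (by norm_num), hfe 2 (by norm_num), hfe 3 (by norm_num), hfe 4 (by norm_num), hfe 5 (by norm_num),
      hfe 6 (by norm_num)]
  have hfe5 : fe5 (bump a 6) = fe5 a := by
    unfold fe5
    rw [hfe 1 (by norm_num), hfe 2 (by norm_num), hfe 3 (by norm_num), hfe 4 (by norm_num), hfe 5 (by norm_num),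
      hfe 6 (by norm_num)]
  have h10 : ((bump a 6 0 : ℤ) : ℚ) = (a 0 : ℚ) := by rw [hb1_0]
  have h17 : ((bump a 6 7 : ℤ) : ℚ) = (a 7 : ℚ) + 1 := by rw [hb1_7]; push_cast; ring
  rw [hfe1, hfe2, hfe3, hfe4, hfe5, h10, h17, hnq]
  simp only [Pup, Pz, Pm1, Pm2, EK, Pzero, Pminus1, Pminus2, eS1, eS2, eS3, eS4, eS5, Fin.prod_univ_six] at R
  rw [hnq, hc0, hc1, hc2, hc3, hc4, hc5] at R
  unfold gammaOne gammaTwo qA1 qA2 qA3 yN at R ⊢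
  unfold fe1 fe2 fe3 fe4 fe5
  simp only [Finset.prod_range_succ, Finset.prod_range_zero, one_mul]
  linear_combination R

end Bridge

end Summit.KontsevichZagierPeriods.Zeta5Search.WedgeDictionary.OmegaRec
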